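import Literature.NumberTheory.Automorphic.SmoothRepresentation
import HarnessLib

/-!
# Discharged fact: the contragredient of an admissible representation is admissible

`Literature.NumberTheory.Automorphic.SmoothRepresentation` records as a named fact
(`Representation.isAdmissible_contragredient ρ : Prop`) that for a representation `ρ` of a
locally profinite group `G` (`[NonarchimedeanGroup G] [LocallyCompactSpace G] [T2Space G]`) on a
vector space `V` over a field `k` of characteristic zero, admissibility of `ρ` implies
admissibility of the smooth contragredient `ρ.contragredientRep` (the smooth part of the
algebraic dual). This file proves it (`Representation.isAdmissible_contragredient_holds`), so a
user holding `(h : ρ.isAdmissible_contragredient)` can discharge the hypothesis.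

Sources. Bernstein–Zelevinsky 1976, §2 (2.13–2.14: `Ṽ^K ≅ (V^K)^*` for compact open `K`,
hence `Ṽ` is admissible when `V` is); Bushnell–Henniart, *The local Langlands conjecture for
`GL(2)`*, §2.8–2.10; Bump 1997, §4.2, p. 425 ("the contragredient of an admissible
representation is admissible", via the `K`-isotypic decomposition (2.5)–(2.7)) and
Proposition 4.2.5 (p. 428: the canonical pairing is nondegenerate on `V^{K₀} × Ṽ^{K₀}`), stated
there over `ℂ`.

## Proof

Smoothness of `ρ.contragredientRep` is `Representation.isSmooth_contragredientRep` (the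
contragredient is the smooth part of the dual). For the finiteness condition fix a compact open
subgroup `K`. The restriction map `R : Ṽ^K → (V^K)^*`, `f ↦ f|_{V^K}`, is `k`-linear, and it
is injective: a `K`-fixed `f ∈ Ṽ` is a `K`-invariant linear form `φ` on `V`; if `φ` vanishes on
`V^K` then for any `v ∈ V` the `K`-orbit `S = {ρ g v | g ∈ K}` is finite (the orbit map is
continuous for the discrete topology on `V` because `ρ` is smooth, and `K` is compact), the
vector `w = ∑_{x ∈ S} x` is `K`-fixed (`K` permutes `S`), and
`0 = φ w = ∑_{x ∈ S} φ x = |S| · φ v` by `K`-invariance, so `φ v = 0` as `|S| ≠ 0` in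
the characteristic-zero field `k` (this is the projector `e_K = (1/[K:K']) ∑ ρ g` of the printed
proofs, with the normalisation moved to the other side). Since `V^K` is finite-dimensional by
admissibility of `ρ`, so is `(V^K)^*`, and `Module.Finite.of_injective R` concludes. Only
`[CharZero k]`, separately continuous multiplication on `G` and compactness of `K` are used.

## Main results

* `Representation.sum_mem_fixedPoints_of_finite_orbit`: the sum of a finite `K`-orbit is
  `K`-fixed (any commutative coefficient ring, any group).
* `Representation.IsSmooth.finite_image_apply`: in a smooth representation the orbit of a vector
  under a compact subset of `G` is finite.
* `Representation.IsSmooth.dual_eq_zero_of_forall_mem_fixedPoints`: a `K`-invariant linear form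
  vanishing on `V^K` is zero (`K` with compact carrier, `char k = 0`), i.e. `(V^*)^K → (V^K)^*` is
  injective.
* `Representation.isAdmissible_contragredient_holds`: the discharge.

## References

* I. N. Bernstein, A. V. Zelevinsky, *Representations of the group `GL(n, F)` where `F` is a
  non-archimedean local field*, Russian Math. Surveys 31:3 (1976), 1–68, §2 (2.13–2.14).
  doi:10.1070/RM1976v031n03ABEH001532. [BernsteinZelevinsky1976] (not held at the time of
  writing; statement numbering as recorded on the vendored fact.)
* D. Bump, *Automorphic Forms and Representations*, Cambridge Studies in Advanced Mathematics 55
  (1997), §4.2, p. 425 and Proposition 4.2.5 (p. 428). [Bump1997]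
* C. J. Bushnell, G. Henniart, *The local Langlands conjecture for `GL(2)`* (2006), §§2.8–2.10.
-/

namespace Representation


section OrbitFiniteness

variable {k G V : Type*} [CommRing k] [Group G] [AddCommGroup V] [Module k V]

/-- The sum of the (finite) `K`-orbit of a vector is a `K`-fixed vector: `K` permutes the orbit.
[folklore] -/
lemma sum_mem_fixedPoints_of_finite_orbit (ρ : Representation k G V) (K : Subgroup G) (v : V)
    (hfin : ((fun g : G => ρ g v) '' (K : Set G)).Finite) :
    ∑ x ∈ hfin.toFinset, x ∈ ρ.fixedPoints K := by
  rw [mem_fixedPoints]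
  intro g hg
  rw [map_sum]
  refine Finset.sum_nbij' (fun x => ρ g x) (fun x => ρ g⁻¹ x) ?_ ?_
    (fun x _ => ρ.inv_self_apply g x) (fun x _ => ρ.self_inv_apply g x) (fun _ _ => rfl)
  · intro x hx
    rw [Set.Finite.mem_toFinset] at hx ⊢
    obtain ⟨g', hg', rfl⟩ := hx
    exact ⟨g * g', K.mul_mem hg hg', by simp only [map_mul, Module.End.mul_apply]⟩
  · intro x hx
    rw [Set.Finite.mem_toFinset] at hx ⊢
    obtain ⟨g', hg', rfl⟩ := hx
    exact ⟨g⁻¹ * g', K.mul_mem (K.inv_mem hg) hg',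
      by simp only [map_mul, Module.End.mul_apply]⟩

variable [TopologicalSpace G]

/-- In a smooth representation the orbit `{ρ g v | g ∈ C}` of a vector under a compact set
`C ⊆ G` is finite: the orbit map `g ↦ ρ g v` is continuous for the discrete topology on `V`
(`isSmooth_iff_continuous`), so it maps `C` onto a compact, hence finite, subset of the discrete
space `V`. (Bushnell–Henniart §2.8; implicit in Bernstein–Zelevinsky 1976, §2.13.)
[folklore] -/
lemma IsSmooth.finite_image_apply [SeparatelyContinuousMul G] {ρ : Representation k G V}
    (hρ : ρ.IsSmooth) {C : Set G} (hC : IsCompact C) (v : V) :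
    ((fun g : G => ρ g v) '' C).Finite := by
  letI : TopologicalSpace V := ⊥
  haveI : DiscreteTopology V := ⟨rfl⟩
  have hc : Continuous fun g : G => ρ g v :=
    ((ρ.isSmooth_iff_continuous).1 hρ).comp (continuous_id.prodMk continuous_const)
  exact (hC.image hc).finite_of_discrete

end OrbitFiniteness

section ContragredientFieldProofs

variable {k G V : Type*} [Field k] [Group G] [TopologicalSpace G] [AddCommGroup V] [Module k V]

/-- **Key step** (the projector `e_K` in disguise). Let `ρ` be smooth, `K ≤ G` a subgroup with
compact underlying set, and `k` of characteristic zero. A `K`-invariant linear form `φ` on `V`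
that vanishes on `V^K` vanishes identically: for `v ∈ V` the `K`-orbit `S` of `v` is finite
(`IsSmooth.finite_image_apply`), `w = ∑_{x ∈ S} x ∈ V^K`, and `0 = φ w = |S| · φ v` with
`|S| ≠ 0` in `k`. Equivalently, the restriction map `(V^*)^K → (V^K)^*` is injective.
(Bernstein–Zelevinsky 1976, §2.13–2.14; Bushnell–Henniart §2.8; Bump 1997, proof of
Proposition 4.2.5.) [folklore] -/
lemma IsSmooth.dual_eq_zero_of_forall_mem_fixedPoints [SeparatelyContinuousMul G] [CharZero k]
    {ρ : Representation k G V} (hρ : ρ.IsSmooth) {K : Subgroup G} (hK : IsCompact (K : Set G))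
    (φ : Module.Dual k V) (hinv : ∀ g ∈ K, ∀ v : V, φ (ρ g v) = φ v)
    (hvan : ∀ w ∈ ρ.fixedPoints K, φ w = 0) : φ = 0 := by
  ext v
  have hfin := hρ.finite_image_apply hK v
  have hw := ρ.sum_mem_fixedPoints_of_finite_orbit K v hfin
  have hsum : φ (∑ x ∈ hfin.toFinset, x) = hfin.toFinset.card • φ v := by
    rw [map_sum, ← Finset.sum_const]
    refine Finset.sum_congr rfl fun x hx => ?_
    obtain ⟨g, hg, rfl⟩ := (Set.Finite.mem_toFinset hfin).1 hx
    exact hinv g hg v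
  have hv : v ∈ hfin.toFinset := (Set.Finite.mem_toFinset hfin).2 ⟨1, K.one_mem, by simp⟩
  have hcard : hfin.toFinset.card ≠ 0 := Finset.card_ne_zero_of_mem hv
  have h0 : (hfin.toFinset.card : k) * φ v = 0 := by
    rw [← nsmul_eq_mul, ← hsum]
    exact hvan _ hw
  rcases mul_eq_zero.1 h0 with h | h
  · exact absurd h (Nat.cast_ne_zero.2 hcard)
  · rw [LinearMap.zero_apply]
    exact h

/-- **Discharge of `isAdmissible_contragredient`**: the contragredient of an admissible
representation of a locally profinite group over a field of characteristic zero is admissible.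
Smoothness is `isSmooth_contragredientRep`. For a compact open `K`, the restriction map
`Ṽ^K → (V^K)^*`, `f ↦ f|_{V^K}`, is `k`-linear and injective
(`IsSmooth.dual_eq_zero_of_forall_mem_fixedPoints`: a `K`-fixed `f ∈ Ṽ` is a `K`-invariant
form), and `(V^K)^*` is finite-dimensional because `V^K` is; hence `Ṽ^K` is finite-dimensional
(`Module.Finite.of_injective`). Only `[CharZero k]`, `[NonarchimedeanGroup G]`'s separately
continuous multiplication and compactness of `K` are used.
(Bernstein–Zelevinsky 1976, Proposition 2.14; Bushnell–Henniart §2.8–2.9; Bump 1997, §4.2,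
p. 425 "the contragredient of an admissible representation is admissible" and Proposition 4.2.5,
stated there over `ℂ`.) [cite: BernsteinZelevinsky1976, Proposition 2.14]
[cite: Bump1997, §4.2 p. 425 and Proposition 4.2.5] -/
theorem isAdmissible_contragredient_holds (ρ : Representation k G V) :
    ρ.isAdmissible_contragredient := by
  intro _ _ _ _ hρ
  refine ⟨ρ.isSmooth_contragredientRep, fun K hK => ?_⟩
  haveI : Module.Finite k (ρ.fixedPoints (K : Subgroup G)) := hρ.2 K hK
  have hK' : IsCompact ((K : Subgroup G) : Set G) := hK
  -- the restriction map `Ṽ^K → (V^K)^*`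
  let R : ρ.contragredientRep.fixedPoints (K : Subgroup G) →ₗ[k]
      Module.Dual k (ρ.fixedPoints (K : Subgroup G)) :=
    (ρ.fixedPoints (K : Subgroup G)).subtype.dualMap ∘ₗ Contragredient.subtype ρ ∘ₗ
      (ρ.contragredientRep.fixedPoints (K : Subgroup G)).subtype
  refine Module.Finite.of_injective R ((injective_iff_map_eq_zero R).2 fun f hf => ?_)
  -- `φ`, the linear form underlying `f`, is `K`-invariant and vanishes on `V^K`, hence is zero
  have hφ : Contragredient.subtype ρ (f : ρ.Contragredient) = 0 := by
    refine hρ.1.dual_eq_zero_of_forall_mem_fixedPoints hK' _ (fun g hg v => ?_) (fun w hw => ?_)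
    · have h1 := (ρ.contragredientRep.mem_fixedPoints (K : Subgroup G) (f : ρ.Contragredient)).1
        f.2 g⁻¹ ((K : Subgroup G).inv_mem hg)
      have h2 := LinearMap.congr_fun (congrArg (Contragredient.subtype ρ) h1) v
      rw [subtype_contragredientRep_apply] at h2
      simpa only [dual_apply, inv_inv, Module.Dual.transpose_apply, LinearMap.comp_apply] using h2
    · exact LinearMap.congr_fun hf ⟨w, hw⟩
  apply Subtype.ext
  apply Contragredient.subtype_injective ρ
  rw [hφ]
  exact (map_zero (Contragredient.subtype ρ)).symm

end ContragredientFieldProofs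

end Representation
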